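import Summits.QuantumFields.BalabanUV.T4Continuum.Spine.NE1p.DressedRebornMuPartLogConvexWitness

/-!
# T⁴ programme, spine estimate NE1′ (node O3b/H2) — WITNESS «THE RESPONSE AT A REAL SOURCE IS A NONNEGATIVE REAL»: along W35's real source
# pencil the source derivative of the dressed one-cube output, `∂E(s)` for `E(s) = E[actM s](X₀)`, is the LOGARITHMIC DERIVATIVE `∂a∕(1 + a)` of
# `1 + a(s)`, `a(s) = actM s (X₀)` (the activity is holomorphic BECAUSE the output is: `a = e^E − 1`), it is REAL at real sources, and it is
# NON-DECREASING there: `∂E(t + δ) − ∂E(t)` — the response of the `δ`-re-born part at the real source `t` — is a NONNEGATIVE REAL NUMBER for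
# `0 ≤ t`, `0 < δ`, `t + δ < 2`; proof = the previous row's strict midpoint log-convexity at EVERY spacing `δ∕(n+1)`, CHAINED along the
# arithmetic progression into `g(t+h)∕g(t) < g(t+δ+h)∕g(t+δ)` and passed to the limit `h = δ∕(n+1) → 0` through `HasDerivAt.tendsto_slope_zero`

Cell `pub-balaban`, sub-cell `t4`, BINDER-OWNERS row NE1′; NE1′ formalisation crew, unit `b2b-balaban-t4-ne1p-formalise-leaf-06`
(LEAF PROVER 06, generation 14); crew row W111 ∕ DAG N29zzzzzzc of `t4/formal/NE1p/LEAVES.md` (BOOKED typer R-T157 `HOME/CLAIMS.log`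
l.25813 on INTENT l.25665; LANDED p245891 l.25862; cross-read X260 ok (leaf-09-g16); the
seat's FOURTH row, own-lineage follower of «LOG-CONVEX ALONG THE REAL SOURCE PENCIL» `DressedRebornMuPartLogConvexWitness` (p245426)).  ADDITIVE —
imports that module ONLY (→ W101 → W86 → W35 → W33 → W24, W51, S61); THEOREMS ONLY (0 def, 0 `def … : Prop`, 0 cite); every toy datum BY NAME
(`actM`, `cM`, `incr`, `E1`, `X₀`, W24 `exp_locE_cube`, W35 `norm_actM_X₀_lt_one`, W86 `actM_real_X₀`, W51 `analyticEnd_fires`, the previous row's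
`one_add_act_pos` ∕ `strict_logConvex`); Mathlib `HasDerivAt.comp_ofReal` ∕ `real_of_complex` ∕ `ofReal_comp` ∕ `tendsto_slope_zero`,
`le_of_tendsto_of_tendsto'`; nothing restated.

WHY THIS FILE.  The crew's response witnesses at the cores (W51 `deriv_not_identically_zero`, W101 `response_not_identically_zero`, the previous
row's `response_not_identically_zero_on_window`) say the source derivative does not vanish identically; none says WHICH WAY it points.  For the
Gaussian-core datum the answer is structural: `log(1 + a)` is convex along the real pencil, so its derivative — the real response — grows.
Getting there in kernel WITHOUT differentiating under W35's Gaussian integral and WITHOUT a «midpoint-convex + continuous ⇒ convex» lemma: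
* §1 `exp_locE_eq` (`e^{E(s)} = 1 + a(s)` on `‖s‖ < 2`), `differentiableOn_act` (`a = e^E − 1` is holomorphic on the disc — W51 composed with
  `exp`), **`deriv_locE_mul_eq`** (`∂E(s)·(1 + a(s)) = ∂a(s)`: chain rule on `exp ∘ E = 1 + a` near `s`, uniqueness of derivatives).
* §2 [folklore] `deriv_im_eq_zero_of_real_on_real` (a holomorphic function real on the real axis has a real derivative at real points);
  `deriv_act_im_eq_zero`, `deriv_locE_im_eq_zero` (`∂a(t)`, `∂E(t) ∈ ℝ` for `0 ≤ t < 2` — W86 `actM_real_X₀`).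
* §3 [folklore] **`ratio_chain`** (strict midpoint log-convexity at spacing `h` along `t + jh` ⇒ the growth ratio `g(t+jh+h)∕g(t+jh)` is strictly
  increasing in `j`), **`logDeriv_le_of_chain`** (with `h = δ∕(n+1)`: `g(t+h)∕g(t) < g(t+δ+h)∕g(t+δ)` in slope form for every `n`, slopes →
  derivatives as `n → ∞` ⇒ `g'(t)∕g(t) ≤ g'(t+δ)∕g(t+δ)`).
* §4 **`logDeriv_act_mono`** (the previous row's `strict_logConvex` supplies the chain at every spacing; `HasDerivAt.real_of_complex` turns the
  complex `∂a` into the real derivative of `g(s) = 1 + cM·(√π + ∫ incr (s·r))`); **`response_real_nonneg`**: for `0 < r`, `0 ≤ t`, `0 < δ`,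
  `t + δ < 2`, `Im(∂E(t+δ) − ∂E(t)) = 0` and `0 ≤ Re(∂E(t+δ) − ∂E(t))`; decided `example` at `(t, δ) = (0, 1)`.

HONEST FRAMING.  A decided toy on pv22's periodic carrier; [folklore] one-variable calculus only (chain rule, uniqueness of derivatives, real
and imaginary parts of derivatives along the real axis, limits of difference quotients); the SIGN is a property of W35's CHOSEN Gaussian-core
activity along W33's live table — OUR toy — NOT a statement about Bałaban's (2.14) densities, their μ-derivatives or any printed constant; the
inequality is WEAK (`≤`) — strictness at every real source is NOT claimed (the limit loses it; the previous rows give «not identically zero»);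
no wall discharged: (B1a) exercised at a TOY core only, (w5)∕(w6) NOT discharged on Bałaban's densities; (B1b) ∕ (B3) ∕ (B5) untouched ((B3) =
G-ne9p2-5 UNPRINTED, shared with NE9); 0 binders instantiated on Bałaban's densities; no wall item; the NE1′ wall wording of record v1.8 (T4-DAG
v48) — words, not kind — does NOT move; R-t4r2-Q2 NOT met; ABSOLUTE RULE honoured (no numeral of print; nothing internally minted is cited).
NE1′ ⇐ the named binders — NOT proved, NOT printed; spine PROVED 0∕9; count 9 unchanged.  Rung (B)+1 on ONE finite four-torus — NOT infinite
volume, NOT a mass gap, NOT OS on ℝ⁴, NOT Clay.  HONEST DEPENDENCY: continuum YM on T⁴ ⇐ BetaPertH ∧ nine spine estimates (0/9 proved);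
BetaPertH ⇐ (D1) ∧ (D4) ∧ CAP+tail; G-an2-4 gates asym, D1 and NE2/3/4.
-/

noncomputable section

namespace Summit.QuantumFields.BalabanUV.T4Continuum.NE1p.DressedRebornMuResponseRealSignWitness

open Set Metric MeasureTheory Complex
open Literature.MathematicalPhysics.QuantumFieldTheory.Balaban1983to89
open Literature.MathematicalPhysics.QuantumFieldTheory.Balaban1983to89.B13Resummation (locE)
open Literature.MathematicalPhysics.QuantumFieldTheory.Balaban1983to89.TreeLengthTorus (TDom tsys)
open Literature.MathematicalPhysics.QuantumFieldTheory.Balaban1983to89.TreeLengthTorusGeometry (tgeometry)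
open Summit.QuantumFields.BalabanUV.T4Continuum.NE1p.DressedSmallFieldTorusWitness (X₀ exp_locE_cube)
open Summit.QuantumFields.BalabanUV.T4Continuum.NE1p.DressedSmallFieldCoresWitness (E1 incr incr_nonneg_le)
open Summit.QuantumFields.BalabanUV.T4Continuum.NE1p.DressedSmallFieldCoresMassWitness (cM cM_pos actM norm_actM_X₀_lt_one)
open Summit.QuantumFields.BalabanUV.T4Continuum.NE1p.DressedRebornMuPartBipencilWitness (actM_real_X₀)
open Summit.QuantumFields.BalabanUV.T4Continuum.NE1p.DressedSourceAnalyticWitness (analyticEnd_fires)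
open Summit.QuantumFields.BalabanUV.T4Continuum.NE1p.DressedRebornMuPartLogConvexWitness (one_add_act_pos strict_logConvex)

variable (N : ℕ) [NeZero N] (r : ℝ) (hr : 0 ≤ r)

/-! ## §1 The activity is holomorphic because the output is; `∂E·(1 + a) = ∂a` -/

open Classical in
/-- **`exp E = 1 + a` ON THE WHOLE SOURCE DISC `‖s‖ < 2`** [decided toy]: W24's `exp_locE_cube` with W35's `norm_actM_X₀_lt_one`. [folklore] -/
theorem exp_locE_eq (k : ℕ) {s : ℂ} (hs : ‖s‖ < 2) :
    cexp (locE (tgeometry 4 N).ι (tgeometry 4 N).cubes (actM N r hr k s) ((tgeometry 4 N).cubes (X₀ N))) = 1 + actM N r hr k s (X₀ N) :=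
  exp_locE_cube N (w := actM N r hr k s) (norm_actM_X₀_lt_one N r hr k hs.le)

open Classical in
/-- **THE ACTIVITY IS HOLOMORPHIC IN THE SOURCE BECAUSE THE OUTPUT IS** [decided toy]: `s ↦ a(s) = actM s (X₀) = e^{E(s)} − 1` is complex
differentiable on `‖s‖ < 2` — W51's holomorphy of `E` composed with `exp`; no differentiation under W35's Gaussian integral. [folklore] -/
theorem differentiableOn_act (k : ℕ) : DifferentiableOn ℂ (fun s : ℂ => actM N r hr k s (X₀ N)) (ball (0 : ℂ) 2) := by
  have hE := (analyticEnd_fires N r hr (μ₁ := 2) le_rfl k).1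
  have h : ∀ s ∈ ball (0 : ℂ) 2, actM N r hr k s (X₀ N) =
      cexp (locE (tgeometry 4 N).ι (tgeometry 4 N).cubes (actM N r hr k s) ((tgeometry 4 N).cubes (X₀ N))) - 1 := fun s hs => by
    rw [exp_locE_eq N r hr k (mem_ball_zero_iff.1 hs)]; ring
  exact (hE.cexp.sub (differentiableOn_const 1)).congr h

open Classical in
/-- **THE SOURCE DERIVATIVE OF THE OUTPUT IS THE LOGARITHMIC DERIVATIVE OF `1 + a`** [decided toy]: at every `‖s‖ < 2`,
`deriv E s · (1 + a(s)) = deriv a s` (chain rule on `exp ∘ E = 1 + a`, uniqueness of derivatives; `1 + a ≠ 0`). [folklore] -/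
theorem deriv_locE_mul_eq (k : ℕ) {s : ℂ} (hs : ‖s‖ < 2) :
    deriv (fun s : ℂ => locE (tgeometry 4 N).ι (tgeometry 4 N).cubes (actM N r hr k s) ((tgeometry 4 N).cubes (X₀ N))) s *
        (1 + actM N r hr k s (X₀ N)) =
      deriv (fun s : ℂ => actM N r hr k s (X₀ N)) s := by
  have hmem : s ∈ ball (0 : ℂ) 2 := mem_ball_zero_iff.2 hs
  have hE := ((analyticEnd_fires N r hr (μ₁ := 2) le_rfl k).1.differentiableAt (isOpen_ball.mem_nhds hmem)).hasDerivAt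
  have h1 := hE.cexp
  -- `exp ∘ E = 1 + a` near `s`
  have hev : (fun s : ℂ => cexp (locE (tgeometry 4 N).ι (tgeometry 4 N).cubes (actM N r hr k s) ((tgeometry 4 N).cubes (X₀ N)))) =ᶠ[nhds s]
      fun s : ℂ => 1 + actM N r hr k s (X₀ N) := by
    filter_upwards [isOpen_ball.mem_nhds hmem] with z hz using exp_locE_eq N r hr k (mem_ball_zero_iff.1 hz)
  have h2 : HasDerivAt (fun s : ℂ => 1 + actM N r hr k s (X₀ N))
      (cexp (locE (tgeometry 4 N).ι (tgeometry 4 N).cubes (actM N r hr k s) ((tgeometry 4 N).cubes (X₀ N))) *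
        deriv (fun s : ℂ => locE (tgeometry 4 N).ι (tgeometry 4 N).cubes (actM N r hr k s) ((tgeometry 4 N).cubes (X₀ N))) s) s :=
    h1.congr_of_eventuallyEq hev.symm
  have h3 : HasDerivAt (fun s : ℂ => actM N r hr k s (X₀ N))
      (cexp (locE (tgeometry 4 N).ι (tgeometry 4 N).cubes (actM N r hr k s) ((tgeometry 4 N).cubes (X₀ N))) *
        deriv (fun s : ℂ => locE (tgeometry 4 N).ι (tgeometry 4 N).cubes (actM N r hr k s) ((tgeometry 4 N).cubes (X₀ N))) s) s := by
    have := h2.const_add (-1 : ℂ)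
    simpa using this
  rw [h3.deriv, exp_locE_eq N r hr k hs, mul_comm]

/-! ## §2 Real on the real pencil -/

/-- [folklore] A holomorphic `e : ℂ → ℂ` that is REAL on the real axis has a REAL derivative at real points: read the derivative along
the real direction (`HasDerivAt.comp_ofReal`, `HasDerivAt.real_of_complex`, `HasDerivAt.ofReal_comp`) and compare by uniqueness. -/
theorem deriv_im_eq_zero_of_real_on_real {e : ℂ → ℂ} {e' : ℂ} {t : ℝ} (h : HasDerivAt e e' (t : ℂ))
    (hreal : ∀ x : ℝ, (e (x : ℂ)).im = 0) : e'.im = 0 := by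
  have h1 : HasDerivAt (fun x : ℝ => e (x : ℂ)) e' t := h.comp_ofReal
  have h2 : HasDerivAt (fun x : ℝ => (((e (x : ℂ)).re : ℝ) : ℂ)) ((e'.re : ℝ) : ℂ) t := (h.real_of_complex).ofReal_comp
  have hfun : (fun x : ℝ => (((e (x : ℂ)).re : ℝ) : ℂ)) = fun x : ℝ => e (x : ℂ) := by
    funext x
    exact Complex.ext (by simp) (by simp [hreal x])
  rw [hfun] at h2
  have := h1.unique h2
  rw [this]; exact Complex.ofReal_im _

open Classical in
/-- **THE SOURCE DERIVATIVE OF THE ACTIVITY IS REAL ON THE REAL PENCIL** [decided toy]: for a real source `0 ≤ t < 2`,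
`deriv a (t) ∈ ℝ` — `a` is real-valued on real sources (W86 `actM_real_X₀`), so the complex derivative of the holomorphic `a` at a real point,
read along the real direction (`HasDerivAt.comp_ofReal`), has vanishing imaginary part. [folklore] -/
theorem deriv_act_im_eq_zero (k : ℕ) {t : ℝ} (ht0 : 0 ≤ t) (ht : t < 2) :
    (deriv (fun s : ℂ => actM N r hr k s (X₀ N)) (t : ℂ)).im = 0 := by
  have hmem : (t : ℂ) ∈ ball (0 : ℂ) 2 := by
    rw [mem_ball_zero_iff, Complex.norm_real, Real.norm_eq_abs, abs_of_nonneg ht0]; exact ht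
  have hd := ((differentiableOn_act N r hr k).differentiableAt (isOpen_ball.mem_nhds hmem)).hasDerivAt
  refine deriv_im_eq_zero_of_real_on_real hd fun x => ?_
  show (actM N r hr k (x : ℂ) (X₀ N)).im = 0
  rw [actM_real_X₀]; exact Complex.ofReal_im _

open Classical in
/-- **… AND SO IS THE RESPONSE OF THE OUTPUT**: `deriv E (t) ∈ ℝ` for `0 ≤ t < 2` (`deriv E · (1 + a) = deriv a` with `1 + a(t)` real and
positive). [folklore] -/
theorem deriv_locE_im_eq_zero (k : ℕ) {t : ℝ} (ht0 : 0 ≤ t) (ht : t < 2) :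
    (deriv (fun s : ℂ => locE (tgeometry 4 N).ι (tgeometry 4 N).cubes (actM N r hr k s) ((tgeometry 4 N).cubes (X₀ N))) (t : ℂ)).im = 0 := by
  have hs : ‖(t : ℂ)‖ < 2 := by rw [Complex.norm_real, Real.norm_eq_abs, abs_of_nonneg ht0]; exact ht
  have h := deriv_locE_mul_eq N r hr k hs
  have ha := deriv_act_im_eq_zero N r hr k ht0 ht
  rw [actM_real_X₀] at h
  -- `D * (1 + A) = a'` with `1 + A` a positive real and `a'` real ⇒ `D` real
  set D := deriv (fun s : ℂ => locE (tgeometry 4 N).ι (tgeometry 4 N).cubes (actM N r hr k s) ((tgeometry 4 N).cubes (X₀ N))) (t : ℂ)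
  have hA : (1 : ℝ) + cM r * (Real.sqrt Real.pi + ∫ v : E1, incr (t * r) v) ≠ 0 := by
    exact (one_add_act_pos r (mul_nonneg ht0 hr)).ne'
  have hD : D = deriv (fun s : ℂ => actM N r hr k s (X₀ N)) (t : ℂ) / ((((1 : ℝ) + cM r * (Real.sqrt Real.pi + ∫ v : E1, incr (t * r) v) : ℝ)) : ℂ) := by
    rw [eq_div_iff (Complex.ofReal_ne_zero.2 hA), ← h]; push_cast; ring
  rw [hD, Complex.div_ofReal_im, ha, zero_div]

/-! ## §3 Chaining strict midpoint log-convexity: the one-step growth ratio increases along an arithmetic progression -/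

/-- [folklore] **RATIO CHAIN**: if `g > 0` from `t` on and `g(t + jh + h)² < g(t + jh)·g(t + jh + 2h)` for every `j` (`0 ≤ h`), the growth
ratio `q_j = g(t + jh + h)∕g(t + jh)` is strictly increasing in `j`; in particular `q_0 < q_n` for `1 ≤ n`. -/
theorem ratio_chain {g : ℝ → ℝ} {t h : ℝ} (hh : 0 ≤ h) (hpos : ∀ s, t ≤ s → 0 < g s)
    (hlc : ∀ j : ℕ, g (t + j * h + h) ^ 2 < g (t + j * h) * g (t + j * h + 2 * h)) :
    ∀ n : ℕ, 1 ≤ n → g (t + h) / g t < g (t + n * h + h) / g (t + n * h) := by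
  have hp : ∀ j : ℕ, 0 < g (t + j * h) := fun j => hpos _ (le_add_of_nonneg_right (by positivity))
  -- one step: `q_j < q_{j+1}`
  have step : ∀ j : ℕ, g (t + j * h + h) / g (t + j * h) < g (t + (j + 1 : ℕ) * h + h) / g (t + (j + 1 : ℕ) * h) := by
    intro j
    have e : t + ((j + 1 : ℕ) : ℝ) * h = t + j * h + h := by push_cast; ring
    have e2 : t + j * h + h + h = t + j * h + 2 * h := by ring
    rw [e, e2, div_lt_div_iff₀ (hp j) (by rw [← e]; exact hp (j + 1)), ← sq]
    linarith [hlc j, mul_comm (g (t + j * h)) (g (t + j * h + 2 * h))]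
  intro n hn
  induction n with
  | zero => exact absurd hn (by norm_num)
  | succ m ih =>
    rcases Nat.eq_zero_or_pos m with h0 | hm
    · subst h0
      have := step 0
      simp only [Nat.cast_zero, zero_mul, add_zero, zero_add] at this
      simpa using this
    · exact (ih hm).trans (step m)

/-- [folklore] **FROM THE RATIO CHAIN TO THE LOGARITHMIC DERIVATIVES**: if `g > 0` from `t` on, `g` is strictly midpoint-log-convex at EVERY
spacing `h_n = δ∕(n+1)` along the progression from `t` (`0 < δ`), and differentiable at `t` and `t + δ`, then `g'(t)∕g(t) ≤ g'(t+δ)∕g(t+δ)`: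
the slopes at spacing `h_n` satisfy the strict inequality for every `n` (ratio chain with `n + 1` steps) and converge to the derivatives. -/
theorem logDeriv_le_of_chain {g : ℝ → ℝ} {t δ g₀' g₁' : ℝ} (hδ : 0 < δ) (hpos : ∀ s, t ≤ s → 0 < g s)
    (hlc : ∀ n j : ℕ, g (t + j * (δ / (n + 1)) + δ / (n + 1)) ^ 2 <
      g (t + j * (δ / (n + 1))) * g (t + j * (δ / (n + 1)) + 2 * (δ / (n + 1))))
    (hd0 : HasDerivAt g g₀' t) (hd1 : HasDerivAt g g₁' (t + δ)) :
    g₀' / g t ≤ g₁' / g (t + δ) := by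
  -- the spacings `h_n = δ∕(n+1) → 0` within `{0}ᶜ`
  have hseq : Filter.Tendsto (fun n : ℕ => δ / ((n : ℝ) + 1)) Filter.atTop (nhdsWithin 0 {0}ᶜ) := by
    refine tendsto_nhdsWithin_iff.2 ⟨?_, Filter.Eventually.of_forall fun n => ?_⟩
    · have h := (tendsto_const_div_atTop_nhds_zero_nat δ).comp (Filter.tendsto_add_atTop_nat 1)
      refine h.congr fun n => ?_
      simp [Function.comp, Nat.cast_add, Nat.cast_one]
    · exact (div_pos hδ (by positivity)).ne'
  -- slopes converge to the derivatives
  have hs0 : Filter.Tendsto (fun n : ℕ => (δ / ((n : ℝ) + 1))⁻¹ • (g (t + δ / ((n : ℝ) + 1)) - g t)) Filter.atTop (nhds g₀') :=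
    hd0.tendsto_slope_zero.comp hseq
  have hs1 : Filter.Tendsto (fun n : ℕ => (δ / ((n : ℝ) + 1))⁻¹ • (g (t + δ + δ / ((n : ℝ) + 1)) - g (t + δ)))
      Filter.atTop (nhds g₁') := hd1.tendsto_slope_zero.comp hseq
  have hgt : 0 < g t := hpos t le_rfl
  have hgd : 0 < g (t + δ) := hpos _ (by linarith)
  -- the strict inequality at every `n`
  have hlt : ∀ n : ℕ, (δ / ((n : ℝ) + 1))⁻¹ • (g (t + δ / ((n : ℝ) + 1)) - g t) / g t ≤
      (δ / ((n : ℝ) + 1))⁻¹ • (g (t + δ + δ / ((n : ℝ) + 1)) - g (t + δ)) / g (t + δ) := by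
    intro n
    set h := δ / ((n : ℝ) + 1) with hh
    have hhpos : 0 < h := div_pos hδ (by positivity)
    have hc := ratio_chain hhpos.le hpos (hlc n) (n + 1) (by omega)
    have e1 : t + (((n + 1 : ℕ)) : ℝ) * h = t + δ := by
      rw [hh]; push_cast; field_simp
    rw [e1] at hc
    -- `g(t+h)∕g t < g(t+δ+h)∕g(t+δ)` ⇒ the slope form
    rw [smul_eq_mul, smul_eq_mul]
    have k1 : h⁻¹ * (g (t + h) - g t) / g t = (g (t + h) / g t - 1) / h := by
      field_simp
    have k2 : h⁻¹ * (g (t + δ + h) - g (t + δ)) / g (t + δ) = (g (t + δ + h) / g (t + δ) - 1) / h := by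
      field_simp
    rw [k1, k2]
    exact le_of_lt (div_lt_div_of_pos_right (by linarith) hhpos)
  exact le_of_tendsto_of_tendsto' (hs0.div_const (g t)) (hs1.div_const (g (t + δ))) hlt

/-! ## §4 THE SIGN OF THE RESPONSE AT REAL SOURCES -/

open Classical in
/-- **THE LOGARITHMIC DERIVATIVE OF `1 + a` IS NON-DECREASING ALONG THE NONNEGATIVE REAL SOURCE PENCIL** [decided toy]: for `0 < r`,
`0 ≤ t`, `0 < δ`, `t + δ < 2`, reading the real function `g(s) = 1 + cM·(√π + ∫ incr (s·r))` and the REAL parts of the complex source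
derivatives of the activity (which ARE the derivatives: `deriv_act_im_eq_zero`):
`Re a'(t)∕g(t) ≤ Re a'(t+δ)∕g(t+δ)` — row W⟨log-convex⟩'s `strict_logConvex` at every spacing `δ∕(n+1)`, chained and passed to the limit. -/
theorem logDeriv_act_mono (hr0 : 0 < r) (k : ℕ) {t δ : ℝ} (ht : 0 ≤ t) (hδ : 0 < δ) (h2 : t + δ < 2) :
    (deriv (fun s : ℂ => actM N r hr k s (X₀ N)) (t : ℂ)).re / (1 + cM r * (Real.sqrt Real.pi + ∫ v : E1, incr (t * r) v)) ≤
      (deriv (fun s : ℂ => actM N r hr k s (X₀ N)) (((t + δ : ℝ)) : ℂ)).re /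
        (1 + cM r * (Real.sqrt Real.pi + ∫ v : E1, incr ((t + δ) * r) v)) := by
  -- the real function and its derivatives at `t`, `t + δ` from the complex ones
  have hmem : ∀ s : ℝ, 0 ≤ s → s < 2 → (s : ℂ) ∈ ball (0 : ℂ) 2 := fun s hs0 hs2 => by
    rw [mem_ball_zero_iff, Complex.norm_real, Real.norm_eq_abs, abs_of_nonneg hs0]; exact hs2
  have hda : ∀ s : ℝ, 0 ≤ s → s < 2 →
      HasDerivAt (fun x : ℝ => 1 + cM r * (Real.sqrt Real.pi + ∫ v : E1, incr (x * r) v))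
        (deriv (fun s : ℂ => actM N r hr k s (X₀ N)) (s : ℂ)).re s := by
    intro s hs0 hs2
    have hd := ((differentiableOn_act N r hr k).differentiableAt (isOpen_ball.mem_nhds (hmem s hs0 hs2))).hasDerivAt
    have h1 := (hd.real_of_complex).const_add 1
    refine h1.congr_of_eventuallyEq (Filter.Eventually.of_forall fun x => ?_)
    show 1 + cM r * (Real.sqrt Real.pi + ∫ v : E1, incr (x * r) v) = 1 + (actM N r hr k (x : ℂ) (X₀ N)).re
    rw [actM_real_X₀, Complex.ofReal_re]
  refine logDeriv_le_of_chain (g := fun x : ℝ => 1 + cM r * (Real.sqrt Real.pi + ∫ v : E1, incr (x * r) v)) hδ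
    (fun s hs => one_add_act_pos r (mul_nonneg (ht.trans hs) hr)) (fun n j => ?_) (hda t ht (by linarith)) (hda (t + δ) (by linarith) h2)
  have hjpos : (0 : ℝ) ≤ j * (δ / (n + 1)) := by positivity
  exact strict_logConvex r hr hr0 (t := t + j * (δ / (n + 1))) (δ := δ / (n + 1)) (by linarith) (div_pos hδ (by positivity))

open Classical in
/-- **THE RESPONSE OF THE `δ`-RE-BORN PART AT A REAL SOURCE IS A NONNEGATIVE REAL NUMBER** [decided toy]: for `0 < r`, `0 ≤ t`, `0 < δ`,
`t + δ < 2`: `∂_s E(t+δ) − ∂_s E(t)` (complex source derivatives of the dressed output `E(s) = E[actM s](X₀)` at the two real sources) has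
vanishing imaginary part and NONNEGATIVE real part — `∂E = a'∕(1 + a)` (`deriv_locE_mul_eq`), real on the real pencil, non-decreasing by
`logDeriv_act_mono`. [folklore] -/
theorem response_real_nonneg (hr0 : 0 < r) (k : ℕ) {t δ : ℝ} (ht : 0 ≤ t) (hδ : 0 < δ) (h2 : t + δ < 2) :
    (deriv (fun s : ℂ => locE (tgeometry 4 N).ι (tgeometry 4 N).cubes (actM N r hr k s) ((tgeometry 4 N).cubes (X₀ N))) (((t + δ : ℝ)) : ℂ) -
        deriv (fun s : ℂ => locE (tgeometry 4 N).ι (tgeometry 4 N).cubes (actM N r hr k s) ((tgeometry 4 N).cubes (X₀ N))) (t : ℂ)).im = 0 ∧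
    0 ≤ (deriv (fun s : ℂ => locE (tgeometry 4 N).ι (tgeometry 4 N).cubes (actM N r hr k s) ((tgeometry 4 N).cubes (X₀ N))) (((t + δ : ℝ)) : ℂ) -
        deriv (fun s : ℂ => locE (tgeometry 4 N).ι (tgeometry 4 N).cubes (actM N r hr k s) ((tgeometry 4 N).cubes (X₀ N))) (t : ℂ)).re := by
  have htd0 : 0 ≤ t + δ := by linarith
  -- the two derivatives as real quotients
  have key : ∀ s : ℝ, 0 ≤ s → s < 2 →
      deriv (fun s : ℂ => locE (tgeometry 4 N).ι (tgeometry 4 N).cubes (actM N r hr k s) ((tgeometry 4 N).cubes (X₀ N))) (s : ℂ) =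
        ((((deriv (fun s : ℂ => actM N r hr k s (X₀ N)) (s : ℂ)).re /
          (1 + cM r * (Real.sqrt Real.pi + ∫ v : E1, incr (s * r) v)) : ℝ)) : ℂ) := by
    intro s hs0 hs2
    have hs : ‖(s : ℂ)‖ < 2 := by rw [Complex.norm_real, Real.norm_eq_abs, abs_of_nonneg hs0]; exact hs2
    have h := deriv_locE_mul_eq N r hr k hs
    rw [actM_real_X₀] at h
    set D := deriv (fun s : ℂ => locE (tgeometry 4 N).ι (tgeometry 4 N).cubes (actM N r hr k s) ((tgeometry 4 N).cubes (X₀ N))) (s : ℂ)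
    set A := deriv (fun s : ℂ => actM N r hr k s (X₀ N)) (s : ℂ) with hA
    set ρ : ℝ := A.re with hρ
    set gs : ℝ := 1 + cM r * (Real.sqrt Real.pi + ∫ v : E1, incr (s * r) v) with hgs
    have hgs0 : gs ≠ 0 := (one_add_act_pos r (mul_nonneg hs0 hr)).ne'
    have hne : ((gs : ℝ) : ℂ) ≠ 0 := Complex.ofReal_ne_zero.2 hgs0
    have ha : A = (ρ : ℂ) := by
      refine Complex.ext (by simp [hρ]) ?_
      rw [Complex.ofReal_im, hA]; exact deriv_act_im_eq_zero N r hr k hs0 hs2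
    have h2 : D * ((gs : ℝ) : ℂ) = A := by rw [hgs]; exact_mod_cast h
    have h3 : D = A / ((gs : ℝ) : ℂ) := by rw [← h2, mul_div_assoc, div_self hne, mul_one]
    rw [h3, ha, ← Complex.ofReal_div]
  refine ⟨?_, ?_⟩
  · rw [key (t + δ) htd0 h2, key t ht (by linarith), ← Complex.ofReal_sub, Complex.ofReal_im]
  · rw [key (t + δ) htd0 h2, key t ht (by linarith), ← Complex.ofReal_sub, Complex.ofReal_re]
    exact sub_nonneg.2 (logDeriv_act_mono N r hr hr0 k ht hδ h2)

open Classical in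
/-- **DECIDED**: at the base source `t = 0` and step `δ = 1` (sources `0, 1` inside `‖s‖ < 2`), the response of the re-born part
`∂E(1) − ∂E(0)` is a nonnegative real. [located] -/
example (hr0 : 0 < r) (k : ℕ) :
    (deriv (fun s : ℂ => locE (tgeometry 4 N).ι (tgeometry 4 N).cubes (actM N r hr k s) ((tgeometry 4 N).cubes (X₀ N))) (((0 + 1 : ℝ)) : ℂ) -
        deriv (fun s : ℂ => locE (tgeometry 4 N).ι (tgeometry 4 N).cubes (actM N r hr k s) ((tgeometry 4 N).cubes (X₀ N))) ((0 : ℝ) : ℂ)).im = 0 ∧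
    0 ≤ (deriv (fun s : ℂ => locE (tgeometry 4 N).ι (tgeometry 4 N).cubes (actM N r hr k s) ((tgeometry 4 N).cubes (X₀ N))) (((0 + 1 : ℝ)) : ℂ) -
        deriv (fun s : ℂ => locE (tgeometry 4 N).ι (tgeometry 4 N).cubes (actM N r hr k s) ((tgeometry 4 N).cubes (X₀ N))) ((0 : ℝ) : ℂ)).re :=
  response_real_nonneg N r hr hr0 k le_rfl one_pos (by norm_num)

end Summit.QuantumFields.BalabanUV.T4Continuum.NE1p.DressedRebornMuResponseRealSignWitness

end
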